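import Summits.ValiantsHypothesis.ValiantsHypothesis.Theorems.BarrierLeverPartitionMinorsYOnlyFactor
import Summits.ValiantsHypothesis.ValiantsHypothesis.Theorems.BarrierLeverChowThinRowsForestPrelims

/-!
# Route BarrierLever — items 20195 / 20172: the CUBE REDUCTION (arbitrary columns ⇐ down-closed columns)

Helper file (`--supports stmt-ValiantsHypothesis-20195`; cell valiant-natproofs, rung V4, 𝒟-side of
door (c); seat val-np-p2 gen 8).  Closes NO item; definition-free.  Conventions of items 19717 /
20172 / 20195: `x_a = X (castAdd h a)`, `y_c = X (natAdd h c)`, `E u w = Σ_{a∈u} e_{x_a} + Σ_{c∈w} e_{y_c}`;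
a layout `(u, w)` is CHOW-HIT when some product of `h + h` affine forms `ℓ_q` has
`det[coeff_{E (u i) (w j)} ∏ ℓ] ≠ 0`.

**Mechanism.**  For any polynomial `F`, `coeff_{E U W} (F · (s + y_c)) = s · coeff_{E U W} F +
[c ∈ W] · coeff_{E U (W - c)} F` (`coeff_partitionExpo_mul_C_add_X`).  For an injective column
family `w` let `w'` be its DOWN-COMPRESSION along `c` (`w' j = w j - c` when `c ∈ w j` and `w j - c`
is not itself a column, else `w' j = w j`; the classical shift).  For ANY set-indexed family of column
vectors `A` (`exists_det_compressStep_ne_zero`):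
`det[A (w' j)] ≠ 0 ⟹ ∃ s, det[s · A (w j) + [c ∈ w j] · A (w j - c)] ≠ 0`, since the new matrix is
`(column scaling) · (A ∘ w' + s • N) · (1 + s⁻¹ • P)` with `P² = 0`, and `det (A ∘ w' + s • N) ≠ 0`
for some `s ≠ 0` (`ChowThinAll.exists_ne_zero_det_add_smul_ne_zero`).  Compressions make the family
down-closed direction by direction and keep it so (`compress_closed_self`,
`compress_closed_of_closed`); iterating over a coordinate set (`exists_chowFactors_of_closedColumns`):

**CUBE REDUCTION (`chow_hit_of_downClosedColumns`, next file `…ChowCubeReductionDoor`).**  Rows `u : Fin r → Finset (Fin h)` ARBITRARY,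
columns `w` injective.  If for EVERY injective DOWN-CLOSED column family `δ` some product `g` of `h`
affine forms has `det[coeff_{E (u i) (δ j)} ∏ g] ≠ 0`, then `(u, w)` is Chow-hit, by the `h + h`
forms `g_k`, `s_c + y_c`.  So items 20195 / 20172 reduce to down-closed column families (members of
size `≤ log₂ r`).  Seat numerics (exact; `num/dc*.py`): for thin rows, `h` generic forms hit every
(thin rows × down-closed columns) layout at `h = 4` except the 12 layouts «≥ 5 of the 6 pairs of a
4-set × columns ⊇ all 5 sets of size ≤ 1» (rank obstruction), `h + 1` generic forms hit all 30 329;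
x-private `h` forms hit the full thin row set against all 13 / 621 down-closed families of size
`1 + h + C(h,2)` at `h = 4 / 5`.

WHAT THIS IS NOT: a door (it hits nothing by itself); items 20195 / 20172 / 19717 stay open; nothing
on crux stmt-ValiantsHypothesis-14610 or on `VP` versus `VNP`.
-/

set_option linter.dupNamespace false

namespace Summit.ValiantsHypothesis.ValiantsHypothesis.Theorems.BarrierLever.ChowCube

open Finset MvPolynomial
open Summit.ValiantsHypothesis.ValiantsHypothesis.Theorems.BarrierLever.ChowFactor
  (natAdd_mem_support_partitionExpo partitionExpo_tsub_single)
open Summit.ValiantsHypothesis.ValiantsHypothesis.Theorems.BarrierLever.ChowThinAll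
  (exists_ne_zero_det_add_smul_ne_zero)

variable {h r : ℕ}

/-! ## 1. Down-compression of an injective column family along one coordinate -/

/-- The down-compression of an injective family is injective. -/
theorem compress_injective (w w' : Fin r → Finset (Fin h)) (c : Fin h) (hw : Function.Injective w)
    (hw' : ∀ j, w' j = if c ∈ w j ∧ (∀ j', w j' ≠ (w j).erase c) then (w j).erase c else w j) :
    Function.Injective w' := by
  classical
  intro j₁ j₂ hj
  rw [hw' j₁, hw' j₂] at hj
  by_cases h₁ : c ∈ w j₁ ∧ ∀ j', w j' ≠ (w j₁).erase c
  · rw [if_pos h₁] at hj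
    by_cases h₂ : c ∈ w j₂ ∧ ∀ j', w j' ≠ (w j₂).erase c
    · rw [if_pos h₂] at hj
      apply hw
      rw [← Finset.insert_erase h₁.1, ← Finset.insert_erase h₂.1, hj]
    · rw [if_neg h₂] at hj
      exact absurd hj.symm (h₁.2 j₂)
  · rw [if_neg h₁] at hj
    by_cases h₂ : c ∈ w j₂ ∧ ∀ j', w j' ≠ (w j₂).erase c
    · rw [if_pos h₂] at hj
      exact absurd hj (h₂.2 j₁)
    · rw [if_neg h₂] at hj
      exact hw hj

/-- After compressing along `c` the family is closed under removing `c`. -/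
theorem compress_closed_self (w w' : Fin r → Finset (Fin h)) (c : Fin h)
    (hw' : ∀ j, w' j = if c ∈ w j ∧ (∀ j', w j' ≠ (w j).erase c) then (w j).erase c else w j) :
    ∀ j, c ∈ w' j → ∃ j', w' j' = (w' j).erase c := by
  classical
  intro j hc
  rw [hw' j] at hc ⊢
  by_cases h₁ : c ∈ w j ∧ ∀ j', w j' ≠ (w j).erase c
  · rw [if_pos h₁] at hc
    exact absurd hc (Finset.notMem_erase c (w j))
  · rw [if_neg h₁] at hc ⊢
    have h₂ : ¬ ∀ j', w j' ≠ (w j).erase c := fun hall => h₁ ⟨hc, hall⟩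
    push Not at h₂
    obtain ⟨j₀, hj₀⟩ := h₂
    refine ⟨j₀, ?_⟩
    rw [hw' j₀, if_neg, hj₀]
    rintro ⟨hc₀, -⟩
    rw [hj₀] at hc₀
    exact Finset.notMem_erase c (w j) hc₀

/-- Compressing along `c` preserves closedness under removing any other coordinate `c'`. -/
theorem compress_closed_of_closed (w w' : Fin r → Finset (Fin h)) (c c' : Fin h)
    (hw' : ∀ j, w' j = if c ∈ w j ∧ (∀ j', w j' ≠ (w j).erase c) then (w j).erase c else w j)
    (hcl : ∀ j, c' ∈ w j → ∃ j', w j' = (w j).erase c') :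
    ∀ j, c' ∈ w' j → ∃ j', w' j' = (w' j).erase c' := by
  classical
  by_cases hcc : c' = c
  · subst hcc
    exact compress_closed_self w w' c' hw'
  intro j hc'
  rw [hw' j] at hc' ⊢
  by_cases h₁ : c ∈ w j ∧ ∀ j', w j' ≠ (w j).erase c
  · -- `j` was moved: `w' j = w j - c`
    rw [if_pos h₁] at hc' ⊢
    have hc'w : c' ∈ w j := Finset.mem_of_mem_erase hc'
    obtain ⟨j₀, hj₀⟩ := hcl j hc'w
    have hcj₀ : c ∈ w j₀ := by
      rw [hj₀]
      exact Finset.mem_erase.mpr ⟨fun e => hcc (e.symm ▸ rfl) |>.elim, h₁.1⟩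
    by_cases h₀ : ∀ j', w j' ≠ (w j₀).erase c
    · refine ⟨j₀, ?_⟩
      rw [hw' j₀, if_pos ⟨hcj₀, h₀⟩, hj₀, Finset.erase_right_comm]
    · push Not at h₀
      obtain ⟨j₃, hj₃⟩ := h₀
      refine ⟨j₃, ?_⟩
      have hc₃ : c ∉ w j₃ := by
        rw [hj₃]
        exact Finset.notMem_erase c (w j₀)
      rw [hw' j₃, if_neg (fun hh => hc₃ hh.1), hj₃, hj₀, Finset.erase_right_comm]
  · -- `j` was not moved: `w' j = w j`
    rw [if_neg h₁] at hc' ⊢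
    obtain ⟨j₀, hj₀⟩ := hcl j hc'
    by_cases hcw : c ∈ w j
    · -- then `w j - c` is a column `w j₁`, and `w j₁ - c'` is a column: it is the partner of `j₀`
      have h₂ : ¬ ∀ j', w j' ≠ (w j).erase c := fun hall => h₁ ⟨hcw, hall⟩
      push Not at h₂
      obtain ⟨j₁, hj₁⟩ := h₂
      have hc'₁ : c' ∈ w j₁ := by
        rw [hj₁]
        exact Finset.mem_erase.mpr ⟨hcc, hc'⟩
      obtain ⟨j₂, hj₂⟩ := hcl j₁ hc'₁
      refine ⟨j₀, ?_⟩
      rw [hw' j₀, if_neg, hj₀]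
      rintro ⟨-, hall⟩
      apply hall j₂
      rw [hj₂, hj₁, hj₀, Finset.erase_right_comm]
    · refine ⟨j₀, ?_⟩
      have hc₀ : c ∉ w j₀ := by
        rw [hj₀]
        exact fun hh => hcw (Finset.mem_of_mem_erase hh)
      rw [hw' j₀, if_neg (fun hh => hc₀ hh.1), hj₀]


/-! ## 2. One cube-type factor `s + y_c` -/

/-- **One cube-type factor.**  For any `F`:
`coeff (E u w) (F * (C s + y_c)) = s * coeff (E u w) F + [c ∈ w] * coeff (E u (w.erase c)) F`. -/
theorem coeff_partitionExpo_mul_C_add_X {R : Type*} [CommSemiring R]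
    (F : MvPolynomial (Fin (h + h)) R) (s : R) (c : Fin h) (u w : Finset (Fin h)) :
    coeff (∑ a ∈ u, Finsupp.single (Fin.castAdd h a) 1 + ∑ c' ∈ w, Finsupp.single (Fin.natAdd h c') 1)
        (F * (C s + X (Fin.natAdd h c))) =
      s * coeff (∑ a ∈ u, Finsupp.single (Fin.castAdd h a) 1 +
          ∑ c' ∈ w, Finsupp.single (Fin.natAdd h c') 1) F +
        (if c ∈ w then coeff (∑ a ∈ u, Finsupp.single (Fin.castAdd h a) 1 +
          ∑ c' ∈ w.erase c, Finsupp.single (Fin.natAdd h c') 1) F else 0) := by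
  classical
  rw [mul_add, coeff_add, mul_comm F (C s), coeff_C_mul, coeff_mul_X']
  by_cases hc : c ∈ w
  · rw [if_pos ((natAdd_mem_support_partitionExpo u w c).mpr hc), partitionExpo_tsub_single, if_pos hc]
  · rw [if_neg (fun hm => hc ((natAdd_mem_support_partitionExpo u w c).mp hm)), if_neg hc]

/-- The forms `s + y_c` have total degree `≤ 1`. -/
theorem totalDegree_C_add_X_natAdd_le (s : ℂ) (c : Fin h) :
    ((C s + X (Fin.natAdd h c)) : MvPolynomial (Fin (h + h)) ℂ).totalDegree ≤ 1 :=
  (totalDegree_add _ _).trans (max_le (by rw [totalDegree_C]; exact Nat.zero_le _)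
    (by rw [totalDegree_X]))

/-! ## 3. The one-step determinant lemma -/

/-- **ONE COMPRESSION STEP.**  Let `A` be any set-indexed family of column vectors, `w` an injective
column family and `w'` its down-compression along `c`.  If `det[A (w' j)] ≠ 0` then for some scalar
`s`, `det[s · A (w j) + [c ∈ w j] · A ((w j).erase c)] ≠ 0`.  (Factorisation
`(column scaling) · (A ∘ w' + s • N) · (1 + s⁻¹ • P)` with `P² = 0`, and generic perturbation.) -/
theorem exists_det_compressStep_ne_zero (A : Finset (Fin h) → Fin r → ℂ)
    (w w' : Fin r → Finset (Fin h)) (c : Fin h) (hw : Function.Injective w)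
    (hw' : ∀ j, w' j = if c ∈ w j ∧ (∀ j', w j' ≠ (w j).erase c) then (w j).erase c else w j)
    (hdet : (Matrix.of fun i j => A (w' j) i).det ≠ 0) :
    ∃ s : ℂ, (Matrix.of fun i j =>
      s * A (w j) i + (if c ∈ w j then A ((w j).erase c) i else 0)).det ≠ 0 := by
  classical
  set B0 : Matrix (Fin r) (Fin r) ℂ := Matrix.of fun i j => A (w' j) i with hB0
  set Nm : Matrix (Fin r) (Fin r) ℂ := Matrix.of fun i j =>
    if c ∈ w j ∧ (∀ j', w j' ≠ (w j).erase c) then A (w j) i else 0 with hNm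
  obtain ⟨s, hs0, hs⟩ := exists_ne_zero_det_add_smul_ne_zero B0 Nm hdet
  refine ⟨s, ?_⟩
  -- column scaling `d j = 1` on the moved columns, `s` elsewhere
  set d : Fin r → ℂ := fun j => if c ∈ w j ∧ (∀ j', w j' ≠ (w j).erase c) then 1 else s with hd
  -- the unipotent correction `P k j = [c ∈ w j ∧ w k = (w j).erase c]`
  set P : Matrix (Fin r) (Fin r) ℂ := Matrix.of fun k j =>
    if c ∈ w j ∧ w k = (w j).erase c then 1 else 0 with hP
  set M0 : Matrix (Fin r) (Fin r) ℂ := Matrix.of fun i j => d j * (B0 + s • Nm) i j with hM0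
  -- (a) `P * P = 0`
  have hPP : P * P = 0 := by
    ext k j
    rw [Matrix.mul_apply, Matrix.zero_apply]
    refine Finset.sum_eq_zero fun l _ => ?_
    rw [hP, Matrix.of_apply, Matrix.of_apply]
    by_cases h1 : c ∈ w l ∧ w k = (w l).erase c
    · by_cases h2 : c ∈ w j ∧ w l = (w j).erase c
      · exfalso
        have : c ∉ w l := by
          rw [h2.2]
          exact Finset.notMem_erase c (w j)
        exact this h1.1
      · rw [if_neg h2, mul_zero]
    · rw [if_neg h1, zero_mul]
  -- (b) `det (1 + s⁻¹ • P) ≠ 0`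
  have hunit : (1 + s⁻¹ • P).det ≠ 0 := by
    have e : (1 + s⁻¹ • P) * (1 - s⁻¹ • P) = 1 := by
      have e1 : (1 + s⁻¹ • P) * (1 - s⁻¹ • P) = 1 - (s⁻¹ • P) * (s⁻¹ • P) := by
        rw [mul_sub, mul_one, add_mul, one_mul]
        abel
      rw [e1, Matrix.smul_mul, Matrix.mul_smul, hPP, smul_zero, smul_zero, sub_zero]
    have e2 := congr_arg Matrix.det e
    rw [Matrix.det_mul, Matrix.det_one] at e2
    exact left_ne_zero_of_mul_eq_one e2
  -- (c) the target matrix is `M0 * (1 + s⁻¹ • P)`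
  have hprod : (Matrix.of fun i j =>
      s * A (w j) i + (if c ∈ w j then A ((w j).erase c) i else 0)) = M0 * (1 + s⁻¹ • P) := by
    ext i j
    rw [Matrix.mul_add, Matrix.mul_one, Matrix.mul_smul, Matrix.add_apply, Matrix.smul_apply,
      Matrix.mul_apply, Matrix.of_apply, smul_eq_mul]
    -- the correction sum `Σ_k M0 i k * P k j`
    have hsum : ∑ k, M0 i k * P k j =
        if c ∈ w j ∧ (∃ j', w j' = (w j).erase c) then s * A ((w j).erase c) i else 0 := by
      by_cases hj : c ∈ w j ∧ ∃ j', w j' = (w j).erase c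
      · rw [if_pos hj]
        obtain ⟨k₀, hk₀⟩ := hj.2
        rw [Finset.sum_eq_single k₀]
        · have hck₀ : c ∉ w k₀ := by
            rw [hk₀]
            exact Finset.notMem_erase c (w j)
          have hw'k₀ : w' k₀ = w k₀ := by rw [hw' k₀, if_neg (fun hh => hck₀ hh.1)]
          rw [hP, Matrix.of_apply, if_pos ⟨hj.1, hk₀⟩, mul_one, hM0, Matrix.of_apply, hd]
          simp only
          rw [if_neg (fun hh => hck₀ hh.1), Matrix.add_apply, Matrix.smul_apply, hB0, hNm,
            Matrix.of_apply, Matrix.of_apply, if_neg (fun hh => hck₀ hh.1), smul_zero, add_zero,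
            hw'k₀, hk₀]
        · intro k _ hk
          rw [hP, Matrix.of_apply, if_neg, mul_zero]
          rintro ⟨-, hk'⟩
          exact hk (hw (hk'.trans hk₀.symm))
        · intro hk₀'
          exact absurd (Finset.mem_univ k₀) hk₀'
      · rw [if_neg hj]
        refine Finset.sum_eq_zero fun k _ => ?_
        rw [hP, Matrix.of_apply, if_neg, mul_zero]
        rintro ⟨hcj, hk⟩
        exact hj ⟨hcj, k, hk⟩
    rw [hsum, hM0, Matrix.of_apply, Matrix.add_apply, Matrix.smul_apply, hB0, hNm, Matrix.of_apply,
      Matrix.of_apply, hd, hw' j, smul_eq_mul]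
    simp only
    by_cases hcj : c ∈ w j
    · rw [if_pos hcj]
      by_cases hmv : ∀ j', w j' ≠ (w j).erase c
      · -- moved column: `A (w j - c) + s A (w j)`, no correction
        have hne : ¬ (c ∈ w j ∧ ∃ j', w j' = (w j).erase c) := fun hh => by
          obtain ⟨j', hj'⟩ := hh.2
          exact hmv j' hj'
        rw [if_pos ⟨hcj, hmv⟩, if_pos ⟨hcj, hmv⟩, if_pos ⟨hcj, hmv⟩, if_neg hne, one_mul, mul_zero,
          add_zero, add_comm]
      · -- column with a partner: `s A (w j)` plus the correction `s⁻¹ * (s * A (w j - c))`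
        have hex : c ∈ w j ∧ ∃ j', w j' = (w j).erase c := by
          refine ⟨hcj, ?_⟩
          by_contra hh
          push Not at hh
          exact hmv hh
        have hne : ¬ (c ∈ w j ∧ ∀ j', w j' ≠ (w j).erase c) := fun hh => hmv hh.2
        rw [if_neg hne, if_neg hne, if_neg hne, if_pos hex, mul_zero, add_zero, ← mul_assoc,
          inv_mul_cancel₀ hs0, one_mul]
    · have hne : ¬ (c ∈ w j ∧ ∀ j', w j' ≠ (w j).erase c) := fun hh => hcj hh.1
      have hne' : ¬ (c ∈ w j ∧ ∃ j', w j' = (w j).erase c) := fun hh => hcj hh.1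
      rw [if_neg hcj, if_neg hne, if_neg hne, if_neg hne, if_neg hne']
      simp only [mul_zero, add_zero]
  -- (d) assemble
  rw [hprod, Matrix.det_mul]
  refine mul_ne_zero ?_ hunit
  rw [hM0, Matrix.det_mul_row]
  refine mul_ne_zero ?_ hs
  rw [Finset.prod_ne_zero_iff]
  intro j _
  rw [hd]
  simp only
  split_ifs
  · exact one_ne_zero
  · exact hs0


/-! ## 4. Iterating over a set of coordinates -/

/-- **CUBE FACTORS ALONG A COORDINATE SET `K`.**  Fix rows `u`, a number `m` of inner forms and a
set `K` of coordinates.  For every injective column family `w`, already down-closed in the directions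
of `K₀`: if every injective column family `δ` that is down-closed in the directions of `K₀ ∪ K` is hit
by some product `g` of `m` affine forms (`det[coeff_{E (u i) (δ j)} ∏ g] ≠ 0`), then for suitable
scalars `s_c` the polynomial `(∏ g) · ∏_{c ∈ K} (s_c + y_c)` hits `(u, w)`. -/
theorem exists_chowFactors_of_closedColumns (u : Fin r → Finset (Fin h)) (m : ℕ)
    (K : Finset (Fin h)) :
    ∀ (K₀ : Finset (Fin h)) (w : Fin r → Finset (Fin h)), Function.Injective w →
      (∀ c ∈ K₀, ∀ j, c ∈ w j → ∃ j', w j' = (w j).erase c) →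
      (∀ δ : Fin r → Finset (Fin h), Function.Injective δ →
        (∀ c ∈ K₀ ∪ K, ∀ j, c ∈ δ j → ∃ j', δ j' = (δ j).erase c) →
        ∃ g : Fin m → MvPolynomial (Fin (h + h)) ℂ, (∀ k, (g k).totalDegree ≤ 1) ∧
          (Matrix.of fun i j : Fin r => coeff
            (∑ a ∈ u i, Finsupp.single (Fin.castAdd h a) 1 +
              ∑ c ∈ δ j, Finsupp.single (Fin.natAdd h c) 1) (∏ k, g k)).det ≠ 0) →
      ∃ g : Fin m → MvPolynomial (Fin (h + h)) ℂ, (∀ k, (g k).totalDegree ≤ 1) ∧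
        ∃ s : Fin h → ℂ, (Matrix.of fun i j : Fin r => coeff
          (∑ a ∈ u i, Finsupp.single (Fin.castAdd h a) 1 +
            ∑ c ∈ w j, Finsupp.single (Fin.natAdd h c) 1)
          ((∏ k, g k) * ∏ c ∈ K, (C (s c) + X (Fin.natAdd h c)))).det ≠ 0 := by
  classical
  induction K using Finset.induction_on with
  | empty =>
    intro K₀ w hw hcl hDC
    obtain ⟨g, hg, hdet⟩ := hDC w hw (fun c hc => hcl c (by simpa using hc))
    refine ⟨g, hg, fun _ => 0, ?_⟩
    rw [Finset.prod_empty, mul_one]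
    exact hdet
  | insert c K hcK ih =>
    intro K₀ w hw hcl hDC
    -- compress along `c`
    set w' : Fin r → Finset (Fin h) := fun j =>
      if c ∈ w j ∧ (∀ j', w j' ≠ (w j).erase c) then (w j).erase c else w j with hw'def
    have hw' : ∀ j, w' j = if c ∈ w j ∧ (∀ j', w j' ≠ (w j).erase c) then (w j).erase c else w j :=
      fun j => rfl
    have hw'inj : Function.Injective w' := compress_injective w w' c hw hw'
    have hcl' : ∀ c' ∈ insert c K₀, ∀ j, c' ∈ w' j → ∃ j', w' j' = (w' j).erase c' := by
      intro c' hc'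
      rcases Finset.mem_insert.mp hc' with e | hc'K₀
      · rw [e]
        exact compress_closed_self w w' c hw'
      · exact compress_closed_of_closed w w' c c' hw' (hcl c' hc'K₀)
    have hDC' : ∀ δ : Fin r → Finset (Fin h), Function.Injective δ →
        (∀ c' ∈ insert c K₀ ∪ K, ∀ j, c' ∈ δ j → ∃ j', δ j' = (δ j).erase c') →
        ∃ g : Fin m → MvPolynomial (Fin (h + h)) ℂ, (∀ k, (g k).totalDegree ≤ 1) ∧
          (Matrix.of fun i j : Fin r => coeff
            (∑ a ∈ u i, Finsupp.single (Fin.castAdd h a) 1 +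
              ∑ c ∈ δ j, Finsupp.single (Fin.natAdd h c) 1) (∏ k, g k)).det ≠ 0 := by
      intro δ hδ hδcl
      refine hDC δ hδ fun c' hc' => hδcl c' ?_
      rw [Finset.insert_union, ← Finset.union_insert]
      exact hc'
    obtain ⟨g, hg, s, hdet⟩ := ih (insert c K₀) w' hw'inj hcl' hDC'
    -- one compression step for the column function of `F = (∏ g) · ∏_{c' ∈ K} (s_{c'} + y_{c'})`
    set F : MvPolynomial (Fin (h + h)) ℂ := (∏ k, g k) * ∏ c' ∈ K, (C (s c') + X (Fin.natAdd h c'))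
      with hF
    set A : Finset (Fin h) → Fin r → ℂ := fun W i => coeff
      (∑ a ∈ u i, Finsupp.single (Fin.castAdd h a) 1 + ∑ c' ∈ W, Finsupp.single (Fin.natAdd h c') 1) F
      with hA
    have hdetA : (Matrix.of fun i j => A (w' j) i).det ≠ 0 := hdet
    obtain ⟨t, ht⟩ := exists_det_compressStep_ne_zero A w w' c hw hw' hdetA
    refine ⟨g, hg, Function.update s c t, ?_⟩
    have hprodK : ∏ c' ∈ K, (C (Function.update s c t c') + X (Fin.natAdd h c') :
        MvPolynomial (Fin (h + h)) ℂ) = ∏ c' ∈ K, (C (s c') + X (Fin.natAdd h c')) := by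
      refine Finset.prod_congr rfl fun c' hc' => ?_
      have hne : c' ≠ c := fun e => hcK (e ▸ hc')
      rw [Function.update_of_ne hne]
    have hpoly : (∏ k, g k) * ∏ c' ∈ insert c K, (C (Function.update s c t c') + X (Fin.natAdd h c')) =
        F * (C t + X (Fin.natAdd h c)) := by
      rw [Finset.prod_insert hcK, Function.update_self, hprodK, hF, mul_assoc, mul_comm (C t + _)]
    have hM : (Matrix.of fun i j : Fin r => coeff
        (∑ a ∈ u i, Finsupp.single (Fin.castAdd h a) 1 + ∑ c' ∈ w j, Finsupp.single (Fin.natAdd h c') 1)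
        ((∏ k, g k) * ∏ c' ∈ insert c K, (C (Function.update s c t c') + X (Fin.natAdd h c')))) =
        Matrix.of fun i j => t * A (w j) i + (if c ∈ w j then A ((w j).erase c) i else 0) := by
      ext i j
      rw [Matrix.of_apply, Matrix.of_apply, hpoly, coeff_partitionExpo_mul_C_add_X]
    rw [hM]
    exact ht

end Summit.ValiantsHypothesis.ValiantsHypothesis.Theorems.BarrierLever.ChowCube
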